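import Literature.NumberTheory.DiophantineGeometry.MatveevYuPlaceBoundsNumberField
import Literature.NumberTheory.DiophantineGeometry.AbcTwoAdicValuationProofs
import HarnessLib

/-!
# STUB-IDEAS `stub_conjugateCuspTriple` — ideator k=1, GEN 8 (FAMILY 1: RECOGNISE & IMPORT) — Sketch

Crux `GoldenCuspShadow` (stmt-ABC-26026, PROVED in tree: `Summit.ABC.ABC.Theorems.goldenCuspShadow_proof`),
route `CuspFieldPencil`. `Q = u² − 11uw − w²`, `R = rad(uwQ)`, `H = max(|u|,|w|)`, `q = rad Q`.

LITERATURE MATCH (new in gen 8). The registered stub `Sig` (`log H ≤ κ_ε R^ε q^{2/3} min(rad u,rad w)^{2/3}`)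
is, up to bookkeeping, ONE application of

  **Győry 2019, Theorem 2** (Publ. Math. Debrecen 94 (2019) 507–526 = arXiv:1901.11289, (2.6) p. 5;
  the `Γ`-version of Le Fourn 2020, ANT 14, Thm 1.4): for `αx + βy = 1` with `x, y` in a finitely
  generated `Γ = ⟨ξ₁,…,ξ_m⟩·tors ⊂ K*`, `max(h x, h y) < 16 c₆ s (P'_S/log* P'_S) θ max(log(c₆ s P'_S), log* θ) H`,
  `θ = ∏ h(ξ_i)`, `H = max(h α, h β, 1)`, `c₆ = 2(m+1) log*(dm)(log* d)²(16ed)^{3m+5}`, and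
  `P'_S` = THIRD LARGEST norm of a prime ideal of `S` —

to the golden unit equation `x₊/(Dw) − x₋/(Dw) = 1` in `K = ℚ(√5)` (`x± = u + β w`, `x₊x₋ = Q`,
`x₊ − x₋ = Dw`, `D = β₃ − β₂ = 5(2θ−1) = 5√5`), with `Γ(u,w) = ⟨fundamental unit, π_𝔭 : 𝔭 ∣ 5wQ⟩`:
NO linear-form bookkeeping (no exponents, no `B`, no `log log H`, no endgame) — heights only.
The exponent is explained by `P'³ ≤ N₁N₂N₃ ≤ ∏_{𝔭∣5wQ} N𝔭 = N(rad(5wQ·𝓞_K)) ≤ rad(5wQ)² ≤ 25 (q·rad w)²`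
(k1-g2 `min_three_pow_le_prod`, PROVED; landed `GoldenFromNFPencil.absNorm_radical_span_intCast_le`).

Contents: §0 statements; §1 DRAFT typing of the named fact (for a typer seat — NOT a Literature fact
here); §2 helper lemmas H1–H6 (`sorry` = prover work, each ≤ 1 cycle); §3 assembly.
`lean check`: errors 0; sorries only in H1–H6 and the two assembly steps marked. Imports are Literature-only on purpose
(the `Summits.…CuspFieldPencil*` modules are cited by name in docstrings; importing them is not needed for the statements).
-/

set_option linter.dupNamespace false

noncomputable section

open Real NumberField UniqueFactorizationMonoid Height IsDedekindDomain Finset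
open Literature.IUT.LogVolume

namespace Summit.ABC.ABC.Cruxes.GoldenCuspShadow.SideaK1G8

/-! ## §0 Statements -/

/-- The registered stub `stub_conjugateCuspTriple`, VERBATIM. -/
def Sig : Prop :=
  ∀ ε : ℝ, 0 < ε → ∃ κ : ℝ, ∀ u w : ℤ, IsCoprime u w → u * w * (u ^ 2 - 11 * u * w - w ^ 2) ≠ 0 → Real.log (max (|(u : ℝ)|) (|(w : ℝ)|)) ≤ κ * (((UniqueFactorizationMonoid.radical (u * w * (u ^ 2 - 11 * u * w - w ^ 2))).natAbs : ℕ) : ℝ) ^ (ε : ℝ) * ((((UniqueFactorizationMonoid.radical (u ^ 2 - 11 * u * w - w ^ 2)).natAbs : ℕ) : ℝ) ^ (2 / 3 : ℝ) * (min (((UniqueFactorizationMonoid.radical u).natAbs : ℕ) : ℝ) (((UniqueFactorizationMonoid.radical w).natAbs : ℕ) : ℝ)) ^ (2 / 3 : ℝ))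

/-- `SideW` (IDENTICAL to `SideaK2G8.SideW`, so k2-g8's PROVED `sideU_of_sideW`, `sig_of_sides` apply):
`log H ≤ κ_ε R^ε · q^{2/3} · (rad w)^{2/3}`. -/
def SideW : Prop :=
  ∀ ε : ℝ, 0 < ε → ∃ κ : ℝ, ∀ u w : ℤ, IsCoprime u w → u * w * (u ^ 2 - 11 * u * w - w ^ 2) ≠ 0 →
    Real.log (max (|(u : ℝ)|) (|(w : ℝ)|)) ≤
      κ * (((radical (u * w * (u ^ 2 - 11 * u * w - w ^ 2))).natAbs : ℕ) : ℝ) ^ (ε : ℝ) *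
        ((((radical (u ^ 2 - 11 * u * w - w ^ 2)).natAbs : ℕ) : ℝ) ^ (2 / 3 : ℝ) *
          (((radical w).natAbs : ℕ) : ℝ) ^ (2 / 3 : ℝ))

/-! ## §1 DRAFT typing of the engine (cite-only named fact to be filed by a typer seat)

Equal-or-weaker than print in every slot: `T ⊇ supp(ξ)` (print: `S` minimal), `P' ≥` third largest
norm (print: `=`; the bound is increasing in `P'`), `Θ = ∏ max(h ξᵢ, 1) ≥ θ` (bound increasing in `θ`),
`x, y` given as torsion · monomial in `ξ` (print: `x, y ∈ Γ`). `h = logHeight₁/d` (absolute height, the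
tree's convention in `evertseGyory2022_prop_4_2_4_*`), `N𝔭 = Ideal.absNorm`, `log* a = max(log a, 1)`. -/

/-- DRAFT of `gyory2019_thm2_nf` [cite: Gyory2019 = arXiv:1901.11289, Theorem 2, display (2.6)]. -/
def Gyory2019Thm2Draft : Prop :=
  ∀ (K : Type) [Field K] [NumberField K] (m : ℕ), 1 ≤ m →
  ∀ (ξ : Fin m → K) (T : Finset (HeightOneSpectrum (𝓞 K))) (P' : ℝ) (α β x y : K),
    (∀ i, ξ i ≠ 0) →
    (∀ i, ∀ 𝔭 : HeightOneSpectrum (𝓞 K), 𝔭 ∉ T → ord K 𝔭 (ξ i) = 0) →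
    1 ≤ P' →
    (∀ a ∈ T, ∀ b ∈ T, ∀ c ∈ T, a ≠ b → a ≠ c → b ≠ c →
      (min (Ideal.absNorm a.asIdeal) (min (Ideal.absNorm b.asIdeal) (Ideal.absNorm c.asIdeal)) : ℝ) ≤ P') →
    α ≠ 0 → β ≠ 0 →
    (∃ (ζ : K) (n : ℕ) (e : Fin m → ℤ), 0 < n ∧ ζ ^ n = 1 ∧ x = ζ * ∏ i, ξ i ^ e i) →
    (∃ (ζ : K) (n : ℕ) (e : Fin m → ℤ), 0 < n ∧ ζ ^ n = 1 ∧ y = ζ * ∏ i, ξ i ^ e i) →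
    α * x + β * y = 1 →
      max (logHeight₁ x / (Module.finrank ℚ K : ℝ)) (logHeight₁ y / (Module.finrank ℚ K : ℝ)) <
        16 * (2 * ((m : ℝ) + 1) * max (Real.log ((Module.finrank ℚ K : ℝ) * m)) 1 *
              (max (Real.log (Module.finrank ℚ K : ℝ)) 1) ^ 2 *
              (16 * Real.exp 1 * (Module.finrank ℚ K : ℝ)) ^ (3 * m + 5)) *
          ((Fintype.card (InfinitePlace K) : ℝ) + T.card) *
          (P' / max (Real.log P') 1) *
          (∏ i, max (logHeight₁ (ξ i) / (Module.finrank ℚ K : ℝ)) 1) *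
          max (Real.log ((2 * ((m : ℝ) + 1) * max (Real.log ((Module.finrank ℚ K : ℝ) * m)) 1 *
                  (max (Real.log (Module.finrank ℚ K : ℝ)) 1) ^ 2 *
                  (16 * Real.exp 1 * (Module.finrank ℚ K : ℝ)) ^ (3 * m + 5)) *
                ((Fintype.card (InfinitePlace K) : ℝ) + T.card) * P'))
              (max (Real.log (∏ i, max (logHeight₁ (ξ i) / (Module.finrank ℚ K : ℝ)) 1)) 1) *
          max (logHeight₁ α / (Module.finrank ℚ K : ℝ))
            (max (logHeight₁ β / (Module.finrank ℚ K : ℝ)) 1)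

/-! ## §2 Helper lemmas (abstract `K` with the golden hypotheses; instantiate at
`K = QuadraticAlgebra ℚ 1 1` via `GoldenField.numberField / finrank_eq_two / ringOfIntegers_isPrincipalIdealRing`,
`θ = ⟨ω,_⟩` with `GoldenFromNFPencil.theta_mul_theta`, exactly as k2-g7 `qSideRad_golden` does). -/

section Helpers

variable (K : Type) [Field K] [NumberField K]

/-- **H1 `balancedGenerator` [M−].** In a real quadratic PID with a unit `θ` (`θ² = θ+1`, so
`|σ₁θ| = φ > 1 > |σ₂θ|`), every prime `𝔭` has a generator `π` balanced by a power of `θ`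
(`√N𝔭/φ ≤ |σᵢπ| ≤ φ√N𝔭`), hence `h_K(π) = Σ_σ log max(1,|σπ|) ≤ log N𝔭 + 2 log φ`.
Mathlib: `IsPrincipalIdealRing.principal`, `Ideal.absNorm_span_singleton`,
`Algebra.norm` ↔ product over the two real embeddings; archimedean balancing by `Int.floor` of
`log(|σ₁π₀|/√N𝔭)/log φ`. -/
theorem balancedGenerator (hpid : IsPrincipalIdealRing (𝓞 K)) (hK : Module.finrank ℚ K = 2)
    (θ : 𝓞 K) (hθ : θ * θ = θ + 1) :
    ∃ C : ℝ, 0 ≤ C ∧ ∀ 𝔭 : HeightOneSpectrum (𝓞 K), ∃ g : 𝓞 K,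
      𝔭.asIdeal = Ideal.span {g} ∧
        logHeight₁ (g : K) ≤ Real.log (Ideal.absNorm 𝔭.asIdeal : ℝ) + C := by
  sorry

/-- **H2 `factor_through_generators` [S].** PID bookkeeping: an `X ∈ K*` supported on `T` is a unit
times the monomial in the chosen generators (`Y := X / ∏ π^{ord}` has `ord_𝔭 Y = 0` everywhere, hence
`Y ∈ (𝓞 K)ˣ`: `ord_mul/ord_inv/ord_pow`, `ord_pos_iff_mem` from `Literature.IUT.LogVolume.ArakelovDivisors`,
integrality from all `ord ≥ 0`). The unit is then `ζ · ∏ fundSystem^e` by Mathlib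
`NumberField.Units.exist_unique_eq_mul_prod` (not restated). -/
theorem factor_through_generators (T : Finset (HeightOneSpectrum (𝓞 K))) (gen : HeightOneSpectrum (𝓞 K) → 𝓞 K)
    (hgen : ∀ 𝔭 ∈ T, 𝔭.asIdeal = Ideal.span {gen 𝔭}) (X : K) (hX : X ≠ 0)
    (hsupp : ∀ 𝔭 : HeightOneSpectrum (𝓞 K), 𝔭 ∉ T → ord K 𝔭 X = 0) :
    ∃ ε : (𝓞 K)ˣ, X = ((ε : 𝓞 K) : K) * ∏ 𝔭 ∈ T, ((gen 𝔭 : 𝓞 K) : K) ^ ord K 𝔭 X := by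
  sorry

/-- **H3 `support_conjugate_quotient` [S−].** The golden unit-equation datum: with `β₂ = −3−5θ`,
`β₃ = −8+5θ`, `x₊ = u + β₃w`, `x₋ = u + β₂w`, `D = β₃ − β₂` one has `x₊x₋ = Q` (`GoldenFromNFPencil.formTwo_mul_formThree`),
`x₊ − x₋ = Dw`, `D² = 125` (`sqrtFive_sq`-type), hence `X := x₊/(Dw)`, `Y := −x₋/(Dw)` satisfy `X + Y = 1`,
and every prime at which `X` or `Y` has non-zero order divides `5wQ` (as `x± ∣ Q`, `D ∣ 5√5 ∣ 125`). -/
theorem support_conjugate_quotient (θ : 𝓞 K) (hθ : θ * θ = θ + 1) {u w : ℤ} (huw : IsCoprime u w)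
    (h0 : u * w * (u ^ 2 - 11 * u * w - w ^ 2) ≠ 0) :
    let xp : K := (u : K) + ((-8 : K) + 5 * (θ : K)) * (w : K)
    let xm : K := (u : K) + ((-3 : K) - 5 * (θ : K)) * (w : K)
    let D : K := (-5 : K) + 10 * (θ : K)
    D * (w : K) ≠ 0 ∧ xp / (D * w) + (-(xm / (D * w))) = 1 ∧
      ∀ 𝔭 : HeightOneSpectrum (𝓞 K),
        (ord K 𝔭 (xp / (D * w)) ≠ 0 ∨ ord K 𝔭 (-(xm / (D * w))) ≠ 0) →
          ((5 * w * (u ^ 2 - 11 * u * w - w ^ 2) : ℤ) : 𝓞 K) ∈ 𝔭.asIdeal := by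
  sorry

/-- **H4 `norm_support_le` [S].** The place-cost of the golden unit equation: if `T` is a set of
(distinct) primes all dividing `n ≠ 0`, then `∏_{𝔭∈T} N𝔭 ≤ N(rad(n𝓞_K)) ≤ rad(n)^{[K:ℚ]}`
(`T ⊆` prime factors of `rad(span{n})`, `Ideal.absNorm` multiplicative on the coprime product,
landed `GoldenFromNFPencil.absNorm_radical_span_intCast_le`). With k1-g2 `min_three_pow_le_prod`
(PROVED, crux dir `…_1_g2_sketch.lean` §3) this gives `P'³ ≤ rad(5wQ)² ≤ (25·q·rad w)²`. -/
theorem norm_support_le (T : Finset (HeightOneSpectrum (𝓞 K))) {n : ℤ} (hn : n ≠ 0)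
    (hT : ∀ 𝔭 ∈ T, ((n : ℤ) : 𝓞 K) ∈ 𝔭.asIdeal) :
    ∏ 𝔭 ∈ T, Ideal.absNorm 𝔭.asIdeal ≤ (radical n).natAbs ^ Module.finrank ℚ K := by
  sorry

/-- **H5 `logHeight_quotient_lower` [S].** Height of the unknown vs. `log H`:
`h(x₊/(Dw)) ≥ log max(|u|,|w|) − 4` (`d = 2`): the finite part of `h` at the primes of `w` is
`log|w|` (`x₊` is prime to `w` as `gcd(Q,w)=1`; `N(w) = w²`), and at the two real places
`|σ x₊| ≥ |u|/2` once `|u| ≥ 23|w|` (`|σβ₃| ≤ 11.1`, `|σD| = 5√5`); else `H ≤ 23|w|`.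
Tools: `NumberField.logHeight₁` unfolding used in k2-g6 `logHeight₁_natCast_nf`, `InfinitePlace.mult`. -/
theorem logHeight_quotient_lower (hK : Module.finrank ℚ K = 2) (θ : 𝓞 K) (hθ : θ * θ = θ + 1)
    {u w : ℤ} (huw : IsCoprime u w) (h0 : u * w * (u ^ 2 - 11 * u * w - w ^ 2) ≠ 0) :
    Real.log (max (|(u : ℝ)|) (|(w : ℝ)|)) ≤
      logHeight₁ (((u : K) + ((-8 : K) + 5 * (θ : K)) * (w : K)) / (((-5 : K) + 10 * (θ : K)) * (w : K))) / 2
        + 4 := by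
  sorry

end Helpers

/-- **H6 `absorb_sideW` [S, `K`-free real analysis].** From the shape the engine leaves —
`log H ≤ 4 + A · C^{ω(5wQ)} · (∏_{p∣5wQ} max(log p,1))² · P' · max(log(A C^{ω} P'), log(∏…))` with
`P'³ ≤ 625 (q · rad w)²` (the `P'` is the one A1 chose; RHS is increasing in `P'`) — to `SideW`: absorb `C^{ω}` and `∏ log p` by
`exists_pow_card_primeFactors_le_mul_rpow`, `exists_prod_log_primeFactors_le_mul_rpow`
(`Literature/…/AbcTwoAdicValuationProofs`), and `log R ≤ R^η/η` (`Real.log_le_rpow_div`); constants via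
landed `one_le_radR`, `natAbs_radical_cast`, `radR_prod`. Stated with the prime-factor set of `|5wQ|`. -/
theorem absorb_sideW
    (h : ∃ A C : ℝ, 0 ≤ A ∧ 1 ≤ C ∧ ∀ u w : ℤ, IsCoprime u w → u * w * (u ^ 2 - 11 * u * w - w ^ 2) ≠ 0 →
      ∃ P' : ℝ, 1 ≤ P' ∧
        P' ^ 3 ≤ 625 * ((((radical (u ^ 2 - 11 * u * w - w ^ 2)).natAbs : ℕ) : ℝ) *
                          (((radical w).natAbs : ℕ) : ℝ)) ^ 2 ∧
        Real.log (max (|(u : ℝ)|) (|(w : ℝ)|)) ≤ 4 +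
          A * C ^ (5 * w * (u ^ 2 - 11 * u * w - w ^ 2)).natAbs.primeFactors.card *
            (∏ p ∈ (5 * w * (u ^ 2 - 11 * u * w - w ^ 2)).natAbs.primeFactors, max (Real.log ((p : ℕ) : ℝ)) 1) ^ 2 *
            P' * max (Real.log (A * C ^ (5 * w * (u ^ 2 - 11 * u * w - w ^ 2)).natAbs.primeFactors.card * P'))
                  (Real.log ((∏ p ∈ (5 * w * (u ^ 2 - 11 * u * w - w ^ 2)).natAbs.primeFactors,
                    max (Real.log ((p : ℕ) : ℝ)) 1) ^ 2))) :
    SideW := by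
  sorry

/-! ## §3 Assembly -/

/-- **A1 [S+] `sideW_of_gyory`** — the one engine call. For coprime `u,w` with `uwQ ≠ 0`, at
`K = QuadraticAlgebra ℚ 1 1`: generators `ξ = (fundSystem K) ++ (π_𝔭)_{𝔭 ∈ T}`, `T = {𝔭 ∣ 5wQ}` (H1, H2,
`NumberField.Units.exist_unique_eq_mul_prod`), `α = β = 1` (`H = 1`), `X, Y` from H3, `P' := (∏_{𝔭∈T} N𝔭)^{1/3}`
(H4 + `min_three_pow_le_prod`), `Θ ≤ C^{#T}∏ max(log N𝔭,1) ≤ C'^{ω}(∏_{p∣5wQ} max(log p,1))²` (H1, `N𝔭 ∣ p²`),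
`#T ≤ 2ω(5wQ)`, `s = 2 + #T`; then H5 turns `h(X)` into `log H − 4` and H6 absorbs. -/
theorem sideW_of_gyory (hG : Gyory2019Thm2Draft) : SideW := by
  sorry

/-- **A2 [PROVED elsewhere — copy]** `SideW → Sig`: k2-g8 `SideaK2G8.sideU_of_sideW` (swap `(u,w) ↦ (w,−u)`,
`radical_neg`) and `SideaK2G8.sig_of_sides` (`min_choice`), both sorry-free in
`Cruxes/GoldenCuspShadow/STUB_IDEAS_stub_conjugateCuspTriple_2_g8_Sketch.lean` (same `SideW`/`Sig` text). -/
theorem sig_of_sideW (h : SideW) : Sig := by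
  sorry

/-- The stub, PROVED-MOD-FACT {Győry 2019 Thm 2} once H1–H6, A1 are closed and A2 is copied. -/
theorem stub_conjugateCuspTriple_of_gyory2019 (hG : Gyory2019Thm2Draft) : Sig :=
  sig_of_sideW (sideW_of_gyory hG)

end Summit.ABC.ABC.Cruxes.GoldenCuspShadow.SideaK1G8

end
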